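import Summits.Ventures.CertifiedQuantumChemistry.Certificates.HubbardRingL4U10DQGGap
import Summits.Ventures.CertifiedQuantumChemistry.Rows.BlockScatterPSD
import HarnessLib

/-!
# Ventures/CertifiedQuantumChemistry — Certificates/HubbardRingL4DQGBlocks.lean: the `S_z` BLOCK TABLES of the
# 4-ring pair matrices and the block form of the strict-gap certificate assembly (one file per certificate instead of three)

HONEST FRAMING (verbatim): certified bounds for a stated model Hamiltonian in a stated basis; not a
claim about the real molecule beyond that model. Nothing in this file asserts a value, a row or a claim
node; it is certificate PLUMBING for `hubbardRingTV 4 1 U`, sector `(2, 2)`.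

Seat rdm-B (gen 41), zero compute. The generic §1 of `Certificates/HubbardRingL4U10DQGGap.lean` (gen 40) turns
integer tables `(g, G)` plus kernel checks into `IsDQGFeasibleSector 2 2 γ Γ`, running the exact `LDLᵀ` decision
procedure on the three FULL `64 × 64` matrices `Γ`, `Q(γ, Γ)`, `G(γ, Γ)` (≈ 2–4 min of kernel time each, hence the
three-file chains `…GapTables / …GapQ / …Gap`). With `S_z`-diagonal `γ` and `S_z`-conserving `Γ` — the shape of
every certificate of the line — these matrices are block diagonal:

* PAIR blocks (for `Γ` and `Q`): ordered pairs `(pσ, qτ)` labelled by `σ + τ ∈ {0, 1, 2}` (`↑↑ | ↑↓,↓↑ | ↓↓`),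
  sizes `16 | 32 | 16` — tables `labPair`, `posPair`, `szPair`, enumerations `ePairBlk`;
* PARTICLE–HOLE blocks (for `G`): pairs `(pσ, qτ)` labelled by `(σ, τ) ∈ {σ = τ} | (↑,↓) | (↓,↑)`, sizes
  `32 | 16 | 16` — tables `labPH`, `posPH`, `szPH`, enumerations `ePHBlk`.

§2 feeds `Rows/BlockScatterPSD.lean` (`BlockScatter.posSemidef_real_of_blocks`: per-block `LDLᵀ` verdicts + the
entrywise scatter-sum identity ⇒ PSD over `ℝ`) and gen 40's real→complex transfer: `posSemidef_cast_of_pairBlocks`,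
`posSemidef_cast_of_phBlocks` conclude PSD of the COMPLEX cast of a rational pair matrix from three small kernel runs
(`2·16³ + 32³ ≈ 41 000` elimination steps instead of `64³ ≈ 262 000`). §3 is gen 40's assembly with the three PSD
facts as HYPOTHESES (`isDQGFeasibleSector_of_psd`), so that a certificate may obtain them by any route (full run,
blocks, or a future factorised form); `posSemidef_Gam_of_pairBlocksOK`, `posSemidef_qMap_of_pairBlocksOK`,
`posSemidef_gMap_of_phBlocksOK` are the three one-line entry points a certificate file calls after its `decide +kernel`
runs. Nothing about the tables' mutual consistency is proved or needed: the scatter-sum identity, decided by the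
kernel per certificate, is the only link.

0 `sorry`; twelve small `def`s (ten index tables, two Boolean block checks `pairBlocksOK` / `phBlocksOK`), no `def … : Prop`,
standard axioms. References (docstring-only):
D. A. Mazziotti, Adv. Chem. Phys. 134 (2007) ch. 3 §II.F (spin blocks of the 2-RDM conditions).
-/

set_option linter.style.longLine false
namespace Summit.Ventures.CertifiedQuantumChemistry
open Matrix Finset Literature.MathematicalPhysics.QuantumLattice Literature.MathematicalPhysics.QuantumChemistry
open scoped ComplexOrder

namespace DQGGap

open BlockScatter

/-! ## §1 The block tables of the 64 ordered pairs of spin orbitals of the 4-ring -/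

/-- Decoded pair index: `((p, σ), (q, τ))` for the code `I = ePair (orb p σ, orb q τ)`. -/
def pairDec (I : Fin (4 * 2 * (4 * 2))) : (Fin 4 × Fin 2) × (Fin 4 × Fin 2) :=
  (ofLex (ePair.symm I).1, ofLex (ePair.symm I).2)

/-- PAIR-block label `σ + τ ∈ {0, 1, 2}` (`↑↑`, mixed, `↓↓`). -/
def labPair (I : Fin (4 * 2 * (4 * 2))) : ℕ := ((pairDec I).1.2 : ℕ) + ((pairDec I).2.2 : ℕ)

/-- Position inside the PAIR block: `4p + q` in the like-spin blocks, `16σ + 4p + q` in the mixed block. -/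
def posPair (I : Fin (4 * 2 * (4 * 2))) : ℕ :=
  if (pairDec I).1.2 = (pairDec I).2.2 then 4 * ((pairDec I).1.1 : ℕ) + ((pairDec I).2.1 : ℕ)
  else 16 * ((pairDec I).1.2 : ℕ) + 4 * ((pairDec I).1.1 : ℕ) + ((pairDec I).2.1 : ℕ)

/-- PAIR-block sizes `16 | 32 | 16`. -/
def szPair : ℕ → ℕ
  | 1 => 2 * (4 * 4)
  | _ => 4 * 4

/-- Enumerations of the PAIR blocks (inverse to `posPair` on each block). -/
def ePairBlk : (b : ℕ) → Fin (szPair b) → Fin (4 * 2 * (4 * 2))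
  | 0 => fun a => ePair (orb a.divNat 0, orb a.modNat 0)
  | 1 => fun a => ePair (orb a.modNat.divNat a.divNat, orb a.modNat.modNat (1 - a.divNat))
  | 2 => fun a => ePair (orb a.divNat 1, orb a.modNat 1)
  | _ + 3 => fun a => ePair (orb a.divNat 0, orb a.modNat 0)

/-- PARTICLE–HOLE-block label: `0` if `σ = τ`, `1` for `(↑, ↓)`, `2` for `(↓, ↑)`. -/
def labPH (I : Fin (4 * 2 * (4 * 2))) : ℕ :=
  if (pairDec I).1.2 = (pairDec I).2.2 then 0 else 1 + ((pairDec I).1.2 : ℕ)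

/-- Position inside the PARTICLE–HOLE block: `16σ + 4p + q` in block `0`, `4p + q` in blocks `1`, `2`. -/
def posPH (I : Fin (4 * 2 * (4 * 2))) : ℕ :=
  if (pairDec I).1.2 = (pairDec I).2.2 then 16 * ((pairDec I).1.2 : ℕ) + 4 * ((pairDec I).1.1 : ℕ) + ((pairDec I).2.1 : ℕ)
  else 4 * ((pairDec I).1.1 : ℕ) + ((pairDec I).2.1 : ℕ)

/-- PARTICLE–HOLE-block sizes `32 | 16 | 16`. -/
def szPH : ℕ → ℕ
  | 0 => 2 * (4 * 4)
  | _ => 4 * 4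

/-- Enumerations of the PARTICLE–HOLE blocks (inverse to `posPH` on each block). -/
def ePHBlk : (b : ℕ) → Fin (szPH b) → Fin (4 * 2 * (4 * 2))
  | 0 => fun a => ePair (orb a.modNat.divNat a.divNat, orb a.modNat.modNat a.divNat)
  | 1 => fun a => ePair (orb a.divNat 0, orb a.modNat 1)
  | 2 => fun a => ePair (orb a.divNat 1, orb a.modNat 0)
  | _ + 3 => fun a => ePair (orb a.divNat 0, orb a.modNat 1)

/-! ## §2 PSD of the complex cast of a rational pair matrix from three block runs -/

/-- From the real statement on `toFin M` to the complex matrix on pair indices (gen 40's transfer, factored). -/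
theorem posSemidef_cast_of_toFin_real (M : Orb (Fin 4) × Orb (Fin 4) → Orb (Fin 4) × Orb (Fin 4) → ℚ)
    (h : ((toFin M).map (Rat.cast : ℚ → ℝ)).PosSemidef) :
    Matrix.PosSemidef (Matrix.of fun P R : Orb (Fin 4) × Orb (Fin 4) => (M P R : ℂ)) := by
  have h2 := (posSemidef_map_ofReal h).submatrix ePair
  have h3 : (((toFin M).map (Rat.cast : ℚ → ℝ)).map Complex.ofRealHom).submatrix ePair ePair =
      Matrix.of fun P R : Orb (Fin 4) × Orb (Fin 4) => (M P R : ℂ) := by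
    ext P R
    simp [toFin, Matrix.submatrix_apply, Matrix.map_apply]
  rwa [h3] at h2

/-- **The PAIR-block check** of a rational `64 × 64` matrix in the pair code (Boolean, kernel-evaluable): the three
diagonal blocks `↑↑ | mixed | ↓↓` are symmetric and ACCEPTED by `ExactLDL.ldlAccept`, and the matrix is entrywise
the scatter-sum of these blocks. -/
def pairBlocksOK (A : Matrix (Fin (4 * 2 * (4 * 2))) (Fin (4 * 2 * (4 * 2))) ℚ) : Bool :=
  decide (((A.submatrix (ePairBlk 0) (ePairBlk 0)).IsSymm ∧
      ExactLDL.ldlAccept (szPair 0) (A.submatrix (ePairBlk 0) (ePairBlk 0)) = true) ∧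
    ((A.submatrix (ePairBlk 1) (ePairBlk 1)).IsSymm ∧
      ExactLDL.ldlAccept (szPair 1) (A.submatrix (ePairBlk 1) (ePairBlk 1)) = true) ∧
    ((A.submatrix (ePairBlk 2) (ePairBlk 2)).IsSymm ∧
      ExactLDL.ldlAccept (szPair 2) (A.submatrix (ePairBlk 2) (ePairBlk 2)) = true) ∧
    ∀ I J, A I J = ∑ b ∈ Finset.range 3, scatter (szPair b) labPair posPair b (A.submatrix (ePairBlk b) (ePairBlk b)) I J)

/-- **The PARTICLE–HOLE-block check** (blocks `σ = τ | (↑,↓) | (↓,↑)`), same shape. -/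
def phBlocksOK (A : Matrix (Fin (4 * 2 * (4 * 2))) (Fin (4 * 2 * (4 * 2))) ℚ) : Bool :=
  decide (((A.submatrix (ePHBlk 0) (ePHBlk 0)).IsSymm ∧
      ExactLDL.ldlAccept (szPH 0) (A.submatrix (ePHBlk 0) (ePHBlk 0)) = true) ∧
    ((A.submatrix (ePHBlk 1) (ePHBlk 1)).IsSymm ∧
      ExactLDL.ldlAccept (szPH 1) (A.submatrix (ePHBlk 1) (ePHBlk 1)) = true) ∧
    ((A.submatrix (ePHBlk 2) (ePHBlk 2)).IsSymm ∧
      ExactLDL.ldlAccept (szPH 2) (A.submatrix (ePHBlk 2) (ePHBlk 2)) = true) ∧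
    ∀ I J, A I J = ∑ b ∈ Finset.range 3, scatter (szPH b) labPH posPH b (A.submatrix (ePHBlk b) (ePHBlk b)) I J)

/-- **PAIR-BLOCK ROUTE.** A passing pair-block check on `toFin M` makes the complex cast of the rational pair matrix
`M` positive semidefinite (for `Γ` and `Q`): `2·16³ + 32³` elimination steps instead of `64³`. -/
theorem posSemidef_cast_of_pairBlocksOK (M : Orb (Fin 4) × Orb (Fin 4) → Orb (Fin 4) × Orb (Fin 4) → ℚ)
    (h : pairBlocksOK (toFin M) = true) :
    Matrix.PosSemidef (Matrix.of fun P R : Orb (Fin 4) × Orb (Fin 4) => (M P R : ℂ)) := by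
  obtain ⟨h0, h1, h2, hsum⟩ := of_decide_eq_true h
  refine posSemidef_cast_of_toFin_real M (posSemidef_real_of_blocks 3 (toFin M) szPair labPair posPair ePairBlk
    ?_ ?_ hsum)
  · intro b hb
    interval_cases b
    exacts [h0.1, h1.1, h2.1]
  · intro b hb
    interval_cases b
    exacts [h0.2, h1.2, h2.2]

/-- **PARTICLE–HOLE-BLOCK ROUTE** (for `G`): the same with the particle–hole tables. -/
theorem posSemidef_cast_of_phBlocksOK (M : Orb (Fin 4) × Orb (Fin 4) → Orb (Fin 4) × Orb (Fin 4) → ℚ)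
    (h : phBlocksOK (toFin M) = true) :
    Matrix.PosSemidef (Matrix.of fun P R : Orb (Fin 4) × Orb (Fin 4) => (M P R : ℂ)) := by
  obtain ⟨h0, h1, h2, hsum⟩ := of_decide_eq_true h
  refine posSemidef_cast_of_toFin_real M (posSemidef_real_of_blocks 3 (toFin M) szPH labPH posPH ePHBlk ?_ ?_ hsum)
  · intro b hb
    interval_cases b
    exacts [h0.1, h1.1, h2.1]
  · intro b hb
    interval_cases b
    exacts [h0.2, h1.2, h2.2]

/-- `D`-condition of a tabulated pair by pair blocks: `Γ = G/den` is positive semidefinite over `ℂ`. -/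
theorem posSemidef_Gam_of_pairBlocksOK (den : ℕ) (G : Fin 4 → Fin 2 → Fin 4 → Fin 2 → Fin 4 → Fin 2 → Fin 4 → Fin 2 → ℤ)
    (h : pairBlocksOK (toFin (GamQ den G)) = true) : (Gam den G).PosSemidef :=
  posSemidef_cast_of_pairBlocksOK _ h

/-- `Q`-condition of a tabulated pair by pair blocks, through a precomputed table `Qz` of `Q(γ, Γ)·den`. -/
theorem posSemidef_qMap_of_pairBlocksOK (den : ℕ) (g : Fin 4 → Fin 2 → Fin 4 → Fin 2 → ℤ)
    (G Qz : Fin 4 → Fin 2 → Fin 4 → Fin 2 → Fin 4 → Fin 2 → Fin 4 → Fin 2 → ℤ)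
    (htab : toFin (qMapQ (gamQ den g) (GamQ den G)) = toFin (GamQ den Qz)) (h : pairBlocksOK (toFin (GamQ den Qz)) = true) :
    (qMap (gam den g) (Gam den G)).PosSemidef := by
  rw [← htab] at h
  have e : qMap (gam den g) (Gam den G) = fun p q => (qMapQ (gamQ den g) (GamQ den G) p q : ℂ) :=
    qMap_cast (gamQ den g) (GamQ den G)
  rw [e]
  exact posSemidef_cast_of_pairBlocksOK _ h

/-- `G`-condition of a tabulated pair by particle–hole blocks, through a precomputed table `Gz` of `G(γ, Γ)·den`. -/
theorem posSemidef_gMap_of_phBlocksOK (den : ℕ) (g : Fin 4 → Fin 2 → Fin 4 → Fin 2 → ℤ)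
    (G Gz : Fin 4 → Fin 2 → Fin 4 → Fin 2 → Fin 4 → Fin 2 → Fin 4 → Fin 2 → ℤ)
    (htab : toFin (gMapQ (gamQ den g) (GamQ den G)) = toFin (GamQ den Gz)) (h : phBlocksOK (toFin (GamQ den Gz)) = true) :
    (gMap (gam den g) (Gam den G)).PosSemidef := by
  rw [← htab] at h
  have e : gMap (gam den g) (Gam den G) = fun p q => (gMapQ (gamQ den g) (GamQ den G) p q : ℂ) :=
    gMap_cast (gamQ den g) (GamQ den G)
  rw [e]
  exact posSemidef_cast_of_phBlocksOK _ h

/-! ## §3 The assembly with the three positivity conditions as hypotheses -/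

/-- **THE ASSEMBLY, PSD FORM.** Integer identities on the tables (each decidable) and the three positivity
conditions — however obtained — make `(g/den, G/den)` a `(2, 2)`-sector-DQG-feasible pair of the 4-ring
(gen 40's `isDQGFeasibleSector_of_checks` with its three internal `LDLᵀ` steps replaced by hypotheses). -/
theorem isDQGFeasibleSector_of_psd (den : ℕ) (g : Fin 4 → Fin 2 → Fin 4 → Fin 2 → ℤ)
    (G : Fin 4 → Fin 2 → Fin 4 → Fin 2 → Fin 4 → Fin 2 → Fin 4 → Fin 2 → ℤ) (hden : 0 < den)
    (hherm : ∀ p σ q τ, g p σ q τ = g q τ p σ)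
    (hsel : ∀ p q σ τ, σ ≠ τ → g p σ q τ = 0)
    (hup : ∑ x : Fin 4, g x 0 x 0 = 2 * den) (hdown : ∑ x : Fin 4, g x 1 x 1 = 2 * den)
    (hcontract : ∀ p σ q τ, ∑ r : Fin 4, ∑ μ : Fin 2, G p σ r μ q τ r μ = 3 * g p σ q τ)
    (hfst : ∀ p σ q τ r μ s ν, G q τ p σ r μ s ν = -G p σ q τ r μ s ν)
    (hsnd : ∀ p σ q τ r μ s ν, G p σ q τ s ν r μ = -G p σ q τ r μ s ν)
    (hupUp : ∑ x : Fin 4, ∑ y : Fin 4, G x 0 y 0 x 0 y 0 = 2 * den)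
    (hdownDown : ∑ x : Fin 4, ∑ y : Fin 4, G x 1 y 1 x 1 y 1 = 2 * den)
    (hupDown : ∑ x : Fin 4, ∑ y : Fin 4, G x 0 y 1 x 0 y 1 = 4 * den)
    (hDpsd : (Gam den G).PosSemidef)
    (hQpsd : (qMap (gam den g) (Gam den G)).PosSemidef)
    (hGpsd : (gMap (gam den g) (Gam den G)).PosSemidef) :
    IsDQGFeasibleSector 2 2 (gam den g) (Gam den G) := by
  have hden' : (den : ℚ) ≠ 0 := by exact_mod_cast hden.ne'
  have hs := (toLex (α := Fin 4 × Fin 2)).surjective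
  have hγ : ∀ p σ q τ, gam den g (orb p σ) (orb q τ) = ((g p σ q τ : ℚ) / den : ℚ) := fun _ _ _ _ => rfl
  have hΓ : ∀ p σ q τ r μ s ν, Gam den G (orb p σ, orb q τ) (orb r μ, orb s ν) =
      ((G p σ q τ r μ s ν : ℚ) / den : ℚ) := fun _ _ _ _ _ _ _ _ => rfl
  have hherm' : (gam den g).IsHermitian := by
    refine Matrix.IsHermitian.ext fun i j => ?_
    obtain ⟨⟨p, σ⟩, rfl⟩ := hs i; obtain ⟨⟨q, τ⟩, rfl⟩ := hs j
    show star (gam den g (orb q τ) (orb p σ)) = gam den g (orb p σ) (orb q τ)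
    rw [hγ, hγ, Complex.star_def, map_ratCast, hherm q τ p σ]
  refine ⟨⟨hherm', hDpsd, hQpsd, hGpsd, ?_, ?_, ?_, ?_⟩, ?_, ?_, ?_, ?_, ?_, ?_⟩
  · rw [sum_orb4]; simp only [Fin.sum_univ_two, hγ]
    have h : ∑ x : Fin 4, (((g x 0 x 0 : ℚ) / den : ℚ) : ℂ) + ∑ x : Fin 4, (((g x 1 x 1 : ℚ) / den : ℚ) : ℂ) =
        ((2 + 2 : ℕ) : ℂ) := by
      rw [← Rat.cast_sum, ← Rat.cast_sum, ← Finset.sum_div, ← Finset.sum_div, ← Int.cast_sum, ← Int.cast_sum,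
        hup, hdown]; push_cast; field_simp; ring
    rw [← h, ← Finset.sum_add_distrib]
  · intro i k
    obtain ⟨⟨p, σ⟩, rfl⟩ := hs i; obtain ⟨⟨q, τ⟩, rfl⟩ := hs k
    show ∑ j, Gam den G (orb p σ, j) (orb q τ, j) = (((2 + 2 : ℕ) : ℂ) - 1) * gam den g (orb p σ) (orb q τ)
    rw [sum_orb4]; simp only [hΓ, hγ]
    rw [cast_sum_sum_div (fun x μ => G p σ x μ q τ x μ), hcontract p σ q τ]
    push_cast; ring
  · intro i j R
    obtain ⟨⟨p, σ⟩, rfl⟩ := hs i; obtain ⟨⟨q, τ⟩, rfl⟩ := hs j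
    obtain ⟨R1, R2⟩ := R; obtain ⟨⟨r, μ⟩, rfl⟩ := hs R1; obtain ⟨⟨s, ν⟩, rfl⟩ := hs R2
    show Gam den G (orb q τ, orb p σ) (orb r μ, orb s ν) = -Gam den G (orb p σ, orb q τ) (orb r μ, orb s ν)
    rw [hΓ, hΓ, hfst]; push_cast; ring
  · intro P k l
    obtain ⟨P1, P2⟩ := P; obtain ⟨⟨p, σ⟩, rfl⟩ := hs P1; obtain ⟨⟨q, τ⟩, rfl⟩ := hs P2
    obtain ⟨⟨r, μ⟩, rfl⟩ := hs k; obtain ⟨⟨s, ν⟩, rfl⟩ := hs l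
    show Gam den G (orb p σ, orb q τ) (orb s ν, orb r μ) = -Gam den G (orb p σ, orb q τ) (orb r μ, orb s ν)
    rw [hΓ, hΓ, hsnd]; push_cast; ring
  · intro p q σ τ hστ
    rw [hγ, hsel p q σ τ hστ]; push_cast; ring
  · simp only [hγ]
    rw [← Rat.cast_sum, ← Finset.sum_div, ← Int.cast_sum, hup]; push_cast; field_simp
  · simp only [hγ]
    rw [← Rat.cast_sum, ← Finset.sum_div, ← Int.cast_sum, hdown]; push_cast; field_simp
  · simp only [hΓ]
    rw [cast_sum_sum_div (fun x y => G x 0 y 0 x 0 y 0), hupUp]; push_cast; field_simp; ring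
  · simp only [hΓ]
    rw [cast_sum_sum_div (fun x y => G x 1 y 1 x 1 y 1), hdownDown]; push_cast; field_simp; ring
  · simp only [hΓ]
    rw [cast_sum_sum_div (fun x y => G x 0 y 1 x 0 y 1), hupDown]; push_cast; field_simp; ring

end DQGGap

end Summit.Ventures.CertifiedQuantumChemistry
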